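import Mathlib
import Summits.Ventures.HodgeRepro.Tier4.Line1.SecondCountableGA
import Summits.Ventures.HodgeRepro.Tier4.Line4.L1ClassV3
import Summits.Ventures.HodgeRepro.Tier4.Line4.SpectralL1

/-!
# Tier4/Line4/SpectralL1Display — §15 (3′) `RtfSpectralL1'` is a THEOREM (generic and adelic)

Blind re-derivation cell `pub-hodge-repro`, Tier 4 «PROVE THE STEP» (README §9–§10), LINE L4, cut §15 (3′)
(lead (R-14) S14858; finding S14886; landed S14947), seat t4-L2-p3 (gen 4); the binding of plan-4 g4's v3 display.

* `rtfSpectralL1'_holds`: plan-4's display `RtfSpectralL1' S` (L1ClassV3 — the spectral side with an `L¹` first test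
  UNDER THE POINCARÉ CLAUSE) holds over every second countable `Setting` — it is `rtfSpectralL1_of_poincare`
  (SpectralL1 p700213) by name;
* `rtfSpectralL1'_ofAdelicData`: on `Setting.ofAdelicData W R μ DG fdG compG compT compT'` (typer-2's SettingOfData),
  `G(𝔸)` being second countable (`secondCountable_GA`, L1) — the form the wall's consumers
  (`twoVector_hit_L1'`, `exists_periods_of_J_ne_zero'`, `wall_of_L1_data'`) bind as `hspec`.

Mathlib + the landed modules only; no printed input; nothing here asserts anything about the truth of (P);
HC_CM is NOT proved by anyone in this repository.
-/

set_option autoImplicit false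

noncomputable section

namespace Summit.Ventures.HodgeRepro.Tier4.Line4.L1Class

open MeasureTheory Topology NumberField Summit.Ventures.HodgeRepro.Tier4.Common
  Summit.Ventures.HodgeRepro.Tier4.Line1 Summit.Ventures.HodgeRepro.Tier4.Line1.RTF

section Generic

variable {G : Type} [Group G] [TopologicalSpace G] [IsTopologicalGroup G] [MeasurableSpace G] [BorelSpace G]

/-- **§15 (3′) holds over every second countable `Setting`**: the display `RtfSpectralL1' S` is
`rtfSpectralL1_of_poincare` (the countable unfolding + Parseval + dominated convergence under the Poincaré clause). -/
theorem rtfSpectralL1'_holds [SecondCountableTopology G] (S : Setting G) : RtfSpectralL1' S :=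
  fun _χ _χ' hχ hχ' _τ _φ _n hB _f₁ _f₂ h₁ hP h₂ => S.rtfSpectralL1_of_poincare hχ hχ' hB h₁ hP h₂

end Generic

section Adelic

variable {k : Type} [Field k] [NumberField k] (W : PlaneData k) [MeasurableSpace (GA W)] [BorelSpace (GA W)]
  (R : RTFData W) (μ : Measure (GA W)) [μ.IsHaarMeasure] [R.μT.IsHaarMeasure] [R.μT'.IsHaarMeasure]
  (DG : Set (GA W)) (fdG : IsFundamentalDomain (rationalPoints W) DG μ) (compG : IsCompact (closure DG))
  (compT : IsCompact (closure R.DT)) (compT' : IsCompact (closure R.DT'))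

/-- **§15 (3′) on the adelic setting** of the defined objects: `G(𝔸)` is second countable (`secondCountable_GA`). -/
theorem rtfSpectralL1'_ofAdelicData :
    RtfSpectralL1' (Setting.ofAdelicData W R μ DG fdG compG compT compT') := by
  haveI := secondCountable_GA W
  exact rtfSpectralL1'_holds _

end Adelic

end Summit.Ventures.HodgeRepro.Tier4.Line4.L1Class

end
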